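/-
Copyright (c) 2026 the pub-hodgecm-mathlib formalisation cell (harness21).  Prover seat hodgecm-mathlib-K2Liu-p02 (g9), Track B «K2-LIT» ∕ hLiu418
#184♮, Road I v3, unit U5 «THE CLOSE», FACE-D₀ row `h2₂` (theta side) CLOSED BY NAME: the (B1c′) tie at ONE finite place `v` of `L⁺` over K2E3-p23's
S-letter package, and the `RigidityRowsOn` conjunct `h2₂` through F0P2-p10 (g3)'s hermitian ↔ skew dictionary.  THEOREMS ONLY.
-/
import Summits.HodgeConjecture.HodgeConjecture.Theorems.K2LiuFirstTermLineLiftRankRowAtPlace    -- this seat ★ p864364: `exists_rho_f_at`, `…_of_lineCayley_cont` heads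
import Summits.HodgeConjecture.HodgeConjecture.Theorems.K2LiuFinLineModelLettersAtPlaceD        -- K2E3-p23 PART 3: `exists_letters` (brings ★ p864061 PART 1 `hX`)
import Summits.HodgeConjecture.HodgeConjecture.Theorems.K2LiuHermitianSkewDictionary            -- F0P2-p10 (g3) ★ p864231: `dict_mem_skewMatrices`, `det_dict_ne_zero`
import HarnessLib

/-!
# K2_Liu road (hLiu418 = stmt-HodgeConjecture-24832), FACE-D₀ row `h2₂` (theta side) AT THE PLACE `v`, AND THROUGH THE DICTIONARY

Cell `pub/hodgecm-mathlib` (D-0151), Track B, build stream 29; helper lane `--supports stmt-HodgeConjecture-24832 --as helper`, count-neutral.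

★ p864364 `K2LiuFirstTermLineLiftRankRowAtPlace` leaves, for the theta side of FACE-D₀'s row `h2₂`, exactly K2E3-p23's S-letters at one finite place `v`
(`σ hσ hσF π hπ ψ hψ b hb a ha v hu hρm βloc hherm hdet χ hχ hχS`, packaged as ONE `∃` by ★ `K2LiuFinLineModelLettersAtPlaceD.exists_letters` at the instance
`R := LocalRing L v`, `F := L⁺_v`, `σ := conjLocal v`, `ψ := ψ_{L⁺,v}`, `Z := N_Δ(L⁺_v)`, `ι := ι_v`) and `hX` (★ p864061 `map_adeleFst_toBlocks₁₂_blk_locToAdelic`).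
This file plugs them:
* §1 **`fourierCoeffDelta_thetaLift_eq_zero_at_place`** — for a `T_L`-skew index `S` with `det S ≠ 0`, a finite place `v` and an enumeration `ρ : Fin n ≃ Fin 2`
  (rank `n = 2`): `(B(Φ, fw))_S(h) = 0` for every `Φ ∈ 𝒮(𝔸^{n″})`, `h ∈ H(𝔸)`; **`h2Row_thetaSide_at_place`** — the row on any class `P` ∕ coefficient map `cfS`.
* §2 **`h2Row_of_dict`** — the `RigidityRowsOn` conjunct `h2₂` (★ `K2LiuFirstTermIdentityFaceDefs` :221–:222) ON THE NOSE for the theta side `T₂ = B_{fw} ∘ 𝓣`: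
  `∀ β, (β.map c)ᵀ = β → det β ≠ 0 → coeff β ∘ₗ codRestrict P T₂ hP₂ = 0`, for ANY coefficient family `coeff` reading the Fourier coefficient at the dictionary
  index `dict β := δ • (T_L⁻¹ · reindex ρ⁻¹ ρ⁻¹ β)` (★ `K2LiuFirstTermHolCutRows`' DICT clause at F0P2-p10's `dict`; ★ p864231 `dict_mem_skewMatrices`,
  `det_dict_ne_zero`).
Letters left for the FACE-D₀ assembler: a finite place `v`, `ρ : Fin n ≃ Fin 2`, `νN` finite on compacts, the covering weight supported in a compact (`hK`, `hβK`).

No definition, no instance, no notation, no named-fact hypothesis, no `sorry`; axioms ⊆ {propext, Classical.choice, Quot.sound}.  HONEST LABEL: HC_CM is proved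
only modulo the 7 printed citations (2 remaining named inputs: hLiu418 = stmt-HodgeConjecture-24832, h413 = stmt-HodgeConjecture-24833) until rung 0 closes; this file
moves no counter.

References: [Rallis1984] S. Rallis, Compositio Math. 51 (1984), §4; [KudlaRallis1994] S. Kudla, S. Rallis, Ann. of Math. 140 (1994), §3; [Kudla1994] S. S. Kudla,
Israel J. Math. 87 (1994), §3; [Weil1964] A. Weil, Acta Math. 111 (1964), Chap. I n° 13, Chap. III n° 37–38, n° 41; [Shimura1997] G. Shimura, CBMS 93, §18.1 (18.4);
[Liu2021] App. B Prop. B.8 p. 104.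
-/

set_option autoImplicit false
set_option linter.dupNamespace false
-- the line-pair carriers elaborate to very large types; elaborate sequentially (as in ★ `K2LiuFirstTermLineLiftRankRowModelConj`)
set_option Elab.async false

noncomputable section

open NumberField NumberField.mixedEmbedding MeasureTheory IsDedekindDomain
open scoped Matrix ComplexOrder ENNReal TensorProduct SchwartzMap Classical  -- `Classical`: as ★ p863332

namespace Summit.HodgeConjecture.HodgeConjecture.Cruxes.HLiu418.K2LiuFirstTermLineLiftRankRowAtPlaceDict

open Literature.NumberTheory.Automorphic Literature.NumberTheory.Automorphic.UnitaryGroup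
open Literature.NumberTheory.Automorphic.UnitaryGroup.QuadraticCoordinates
open Literature.NumberTheory.Automorphic.IdeleClassGroup
open Literature.NumberTheory.Automorphic.Liu2021
open Literature.NumberTheory.Automorphic.Liu2021.Def411WeilCarriers
open Literature.NumberTheory.Automorphic.Liu2021.Def411WeilCarriersDoubling
open Literature.NumberTheory.GelbartRogawski1991 Literature.NumberTheory.GelbartRogawski1991.UnitaryDualPair
open Literature.NumberTheory.GelbartRogawski1991.GRConstruction
open Literature.NumberTheory.GaloisRepresentations
open Literature.NumberTheory.Weil1964
open Literature.RepresentationTheory Literature.RepresentationTheory.Liu2021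
open Literature.RepresentationTheory.HeisenbergGroup
open Literature.NumberTheory.K2Lit.DoubledLineTheta Literature.NumberTheory.K2Lit.SiegelDoubled
open Literature.MeasureTheory.Group
open Summit.HodgeConjecture.HodgeConjecture.Cruxes.HLiu418.K2LiuSiegelUnipotentFourierDefs
open Summit.HodgeConjecture.HodgeConjecture.Cruxes.HLiu418.K2LiuSiegelUnipotentCharacters
open Summit.HodgeConjecture.HodgeConjecture.Cruxes.HLiu418.K2LiuSiegelUnipotentLocalDefs
open Summit.HodgeConjecture.HodgeConjecture.Cruxes.HLiu418.K2LiuUnipotentCoveringWeight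
open Summit.HodgeConjecture.HodgeConjecture.Cruxes.HLiu418.K2LiuFirstTermLineLiftRankRow
open Summit.HodgeConjecture.HodgeConjecture.Cruxes.HLiu418.K2LiuFirstTermLineLiftRankRowAtPlace
open Summit.HodgeConjecture.HodgeConjecture.Cruxes.HLiu418.K2LiuFinLineModelLettersAtPlace (map_adeleFst_toBlocks₁₂_blk_locToAdelic)
open Summit.HodgeConjecture.HodgeConjecture.Cruxes.HLiu418.K2LiuFinLineModelLettersAtPlaceD (exists_letters)
open Summit.HodgeConjecture.HodgeConjecture.Cruxes.HLiu418.K2LiuHermitianSkewDictionary (dict_mem_skewMatrices det_dict_ne_zero)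

variable (L : Type) [Field L] [NumberField L] [IsCMField L]
variable {N n : ℕ} (e : Fin N × Fin 1 ≃ Fin n)
  (dV : Fin N → L) (hdV : ∀ i, IsCMField.complexConj L (dV i) = dV i)
  (dW : Fin 1 → L) (hdW : ∀ i, IsCMField.complexConj L (dW i) = dW i)
  {n'' : ℕ} (e₁ : Fin (n + n) × Fin 1 ≃ Fin n'')
  (hdV0 : ∀ i, dV i ≠ 0) (hdW0 : ∀ i, dW i ≠ 0)
  (lam : IdeleClassGroup L →ₜ* Circle) (hlam : IsConjugateSymplectic L lam) (a' : (Fp L)ˣ)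
  (hρ : HasThetaMajorants fun
      (p : ↥(UnitaryGroup.adelic (Fp L) L (IsCMField.complexConj L) (n + n) (Matrix.diagonal (dD L e dV hdV dW hdW))) ×
        ↥(UnitaryGroup.adelic (Fp L) L (IsCMField.complexConj L) 1 (JW (Fp L) L a')))
      (Φ : piSchwartzBruhat (Fp L) (Fin n'')) =>
        pairRep (Fp L) L (IsCMField.complexConj L) (n + n) 1 e₁ (Matrix.diagonal (dD L e dV hdV dW hdW)) (JW (Fp L) L a')
          (chiSplittingLine L e₁ (dD L e dV hdV dW hdW) (dD_conj L e dV hdV dW hdW) (dD_ne_zero L e dV hdV dW hdW hdV0 hdW0)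
            (toHeckeCharacter L lam) (isUnitary_toHeckeCharacter L lam)
            ((isOscillatorChar_toHeckeCharacter_iff lam).mpr hlam) (TW (Fp L) a')
            (isUnit_det_TW (Fp L) a') (JW (Fp L) L a') (JW_eq (Fp L) L a'))
          p Φ)
  [MeasurableSpace (↥(UnitaryGroup.adelic (Fp L) L (IsCMField.complexConj L) 1 (JW (Fp L) L a')) ⧸
    (UnitaryGroup.toAdelic (Fp L) L (IsCMField.complexConj L) 1 (JW (Fp L) L a')).range)]
  [BorelSpace (↥(UnitaryGroup.adelic (Fp L) L (IsCMField.complexConj L) 1 (JW (Fp L) L a')) ⧸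
    (UnitaryGroup.toAdelic (Fp L) L (IsCMField.complexConj L) 1 (JW (Fp L) L a')).range)]
  (μW : Measure (↥(UnitaryGroup.adelic (Fp L) L (IsCMField.complexConj L) 1 (JW (Fp L) L a')) ⧸
    (UnitaryGroup.toAdelic (Fp L) L (IsCMField.complexConj L) 1 (JW (Fp L) L a')).range)) [IsFiniteMeasure μW]
  (fw : C(↥(UnitaryGroup.adelic (Fp L) L (IsCMField.complexConj L) 1 (JW (Fp L) L a')) ⧸
    (UnitaryGroup.toAdelic (Fp L) L (IsCMField.complexConj L) 1 (JW (Fp L) L a')).range, ℂ))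
  [MeasurableSpace (unipDelta L e dV hdV dW hdW)] [BorelSpace (unipDelta L e dV hdV dW hdW)]
  (νN : Measure (unipDelta L e dV hdV dW hdW)) [νN.IsMulLeftInvariant] [IsFiniteMeasureOnCompacts νN]
  {βw : unipDelta L e dV hdV dW hdW → ℝ≥0∞} (hβ : IsCoveringWeight (unipDeltaRat L e dV hdV dW hdW) βw) (hβtop : ∫⁻ u, βw u ∂νN ≠ ∞)
  {K : Set (unipDelta L e dV hdV dW hdW)} (hK : IsCompact K) (hβK : ∀ u, βw u ≤ K.indicator 1 u)
  -- the two letters of the place: a finite place `v` of `L⁺` and an enumeration `ρ` of the rank-`2` index set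
  (v : HeightOneSpectrum (𝓞 (Fp L))) (ρ : Fin n ≃ Fin 2)

include hβ hβtop hK hβK v ρ

/-! ## §1 The (B1c′) tie at the place `v` -/

set_option maxHeartbeats 1000000 in -- idem (★ p864364)
/-- **`(B(Φ, fw))_S ≡ 0` ON `H(𝔸)` FOR EVERY `T_L`-SKEW INDEX `S` WITH `det S ≠ 0`** — ★ p864364 `fourierCoeffDelta_thetaLift_eq_zero_of_lineCayley_cont` at K2E3-p23's
instance: `Z := N_Δ(L⁺_v)`, `ι := ι_v` (`hX` ★ p864061), `ρf` ★ p864364 `exists_rho_f_at`, and the S-letters `exists_letters` (★ `K2LiuFinLineModelLettersAtPlaceD`).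
[cite: Rallis1984, §4] [cite: KudlaRallis1994, §3] [cite: Kudla1994, §3] [cite: Weil1964, Chap. I n° 13, Chap. III n° 37–38, n° 41] -/
theorem fourierCoeffDelta_thetaLift_eq_zero_at_place (S : Matrix (Fin n) (Fin n) L)
    (hS : S ∈ skewMatrices ((IsCMField.complexConj L : L ≃ₐ[Fp L] L) : L →+* L) ((gramR L e dV hdV dW hdW).map (algebraMap (Fp L) L)))
    (hSdet : S.det ≠ 0) (Φ : piSchwartzBruhat (Fp L) (Fin n'')) (h : HA L e dV hdV dW hdW) :
    fourierCoeffDelta L e dV hdV dW hdW νN βw S (doubledLineThetaLift L e dV hdV dW hdW e₁ hdV0 hdW0 lam hlam a' hρ μW Φ fw) h = 0 := by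
  obtain ⟨ρf, hρf, hρf'⟩ := exists_rho_f_at L e dV hdV dW hdW e₁ hdV0 hdW0 a' v
  obtain ⟨π, b, a, vv, βloc, χ, hσ, hσF, hπ, hψ, hb, ha, hu, hρm, hherm, hdet, hχ, hχS⟩ :=
    exists_letters L e dV hdV dW hdW v hdV0 hdW0 ρ e₁ a' S hS hSdet ρf hρf'
  exact fourierCoeffDelta_thetaLift_eq_zero_of_lineCayley_cont L e dV hdV dW hdW e₁ hdV0 hdW0 lam hlam a' hρ μW fw νN hβ hβtop hK hβK S
    (conjLocal L (IsCMField.complexConj L) v) hσ hσF π hπ (adeleAddCharAt (Fp L) v) hψ ρf b hb a ha vv hu hρm βloc hherm hdet χ hχ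
    (fun z : ↥(unipDeltaLoc L e dV hdV dW hdW v) =>
      (⟨locToAdelic L e dV hdV dW hdW v (z : UnitaryGroup.localPi L (IsCMField.complexConj L) (n + n) (hermD L e dV hdV dW hdW) v),
        locToAdelic_mem_unipDelta L e dV hdV dW hdW z.2⟩ : ↥(unipDelta L e dV hdV dW hdW)))
    hχS (fun z => map_adeleFst_toBlocks₁₂_blk_locToAdelic L e dV hdV dW hdW v _) hρf Φ h

set_option maxHeartbeats 1000000 in -- idem
/-- **ROW `h2₂` FOR THE THETA SIDE AT THE PLACE `v`, ON ANY CLASS `P` WITH ANY COEFFICIENT MAP `cfS`**: ★ `coeff_comp_codRestrict_thetaFunctional_eq_zero` ∘ §1.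
[cite: Rallis1984, §4] [cite: KudlaRallis1994, §3] [cite: Liu2021, App. B Prop. B.8 p. 104] -/
theorem h2Row_thetaSide_at_place (S : Matrix (Fin n) (Fin n) L)
    (hS : S ∈ skewMatrices ((IsCMField.complexConj L : L ≃ₐ[Fp L] L) : L →+* L) ((gramR L e dV hdV dW hdW).map (algebraMap (Fp L) L)))
    (hSdet : S.det ≠ 0)
    (P : Submodule ℂ (HA L e dV hdV dW hdW → ℂ)) (cfS : ↥P →ₗ[ℂ] (HA L e dV hdV dW hdW → ℂ))
    (hcf : ∀ (y : ↥P) (h : HA L e dV hdV dW hdW), cfS y h = fourierCoeffDelta L e dV hdV dW hdW νN βw S (y : HA L e dV hdV dW hdW → ℂ) h)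
    {D : Type*} [AddCommGroup D] [Module ℂ D] (𝓣 : D →ₗ[ℂ] piSchwartzBruhat (Fp L) (Fin n''))
    (T₂ : D →ₗ[ℂ] (HA L e dV hdV dW hdW → ℂ))
    (hT₂B : ∀ (x : D) (h : HA L e dV hdV dW hdW),
      T₂ x h = doubledLineThetaLift L e dV hdV dW hdW e₁ hdV0 hdW0 lam hlam a' hρ μW (𝓣 x) fw h)
    (hP₂ : ∀ x, T₂ x ∈ P) :
    cfS ∘ₗ LinearMap.codRestrict P T₂ hP₂ = 0 :=
  coeff_comp_codRestrict_thetaFunctional_eq_zero L e dV hdV dW hdW e₁ hdV0 hdW0 lam hlam a' hρ μW fw νN βw S P cfS hcf 𝓣 T₂ hT₂B hP₂ fun Φ =>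
    fourierCoeffDelta_thetaLift_eq_zero_at_place L e dV hdV dW hdW e₁ hdV0 hdW0 lam hlam a' hρ μW fw νN hβ hβtop hK hβK v ρ S hS hSdet Φ 1

/-! ## §2 The `RigidityRowsOn` conjunct `h2₂` through the dictionary -/

set_option maxHeartbeats 1000000 in -- idem
/-- **THE `RigidityRowsOn` CONJUNCT `h2₂` FOR THE THETA SIDE** (★ `K2LiuFirstTermIdentityFaceDefs` :221–:222 on the nose): for ANY class `P ∋ T₂ x` and ANY
coefficient family `coeff : Matrix (Fin 2) (Fin 2) L → ↥P →ₗ (H(𝔸) → ℂ)` reading the Fourier coefficient at the dictionary index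
`dict β := δ • (T_L⁻¹ · reindex ρ⁻¹ ρ⁻¹ β)` (`hdict` = ★ `K2LiuFirstTermHolCutRows`' DICT clause at F0P2-p10's `dict`), every non-degenerate hermitian `β` has
`coeff β ∘ₗ codRestrict P T₂ hP₂ = 0` — §1 at `S := dict β` (skew ★ `dict_mem_skewMatrices`, `det ≠ 0` ★ `det_dict_ne_zero`).
[cite: Shimura1997, §18.1 (18.4)] [cite: KudlaRallis1994, §3] [cite: Liu2021, App. B Prop. B.8 p. 104] -/
theorem h2Row_of_dict
    (P : Submodule ℂ (HA L e dV hdV dW hdW → ℂ)) (coeff : Matrix (Fin 2) (Fin 2) L → ↥P →ₗ[ℂ] (HA L e dV hdV dW hdW → ℂ))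
    (hdict : ∀ (β : Matrix (Fin 2) (Fin 2) L) (y : ↥P) (h : HA L e dV hdV dW hdW),
      coeff β y h = fourierCoeffDelta L e dV hdV dW hdW νN βw
        (imagUnit L • (((gramR L e dV hdV dW hdW).map (algebraMap (Fp L) L))⁻¹ * Matrix.reindex ρ.symm ρ.symm β)) (y : HA L e dV hdV dW hdW → ℂ) h)
    {D : Type*} [AddCommGroup D] [Module ℂ D] (𝓣 : D →ₗ[ℂ] piSchwartzBruhat (Fp L) (Fin n''))
    (T₂ : D →ₗ[ℂ] (HA L e dV hdV dW hdW → ℂ))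
    (hT₂B : ∀ (x : D) (h : HA L e dV hdV dW hdW),
      T₂ x h = doubledLineThetaLift L e dV hdV dW hdW e₁ hdV0 hdW0 lam hlam a' hρ μW (𝓣 x) fw h)
    (hP₂ : ∀ x, T₂ x ∈ P) :
    ∀ β : Matrix (Fin 2) (Fin 2) L, (β.map (IsCMField.complexConj L))ᵀ = β → β.det ≠ 0 →
      coeff β ∘ₗ LinearMap.codRestrict P T₂ hP₂ = 0 :=
  fun β hβh hβd =>
    h2Row_thetaSide_at_place L e dV hdV dW hdW e₁ hdV0 hdW0 lam hlam a' hρ μW fw νN hβ hβtop hK hβK v ρ _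
      (dict_mem_skewMatrices L e dV hdV dW hdW hdV0 hdW0 ρ β hβh) (det_dict_ne_zero L e dV hdV dW hdW hdV0 hdW0 ρ β hβd)
      P (coeff β) (hdict β) 𝓣 T₂ hT₂B hP₂

end Summit.HodgeConjecture.HodgeConjecture.Cruxes.HLiu418.K2LiuFirstTermLineLiftRankRowAtPlaceDict

end
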